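import Literature.Analysis.FluidPDE.NSLocalAnalyticityRadiusTube
import Mathlib.Analysis.SpecialFunctions.SmoothTransition
import Mathlib.Analysis.InnerProductSpace.Calculus
import HarnessLib

/-!
# Bradshaw–Grujić–Kukavica local analyticity radius: the growing complex regions and the
# adapted contour profiles

Analysis/FluidPDE definitions-layer file for the proof of the named fact
`Literature.Analysis.FluidPDE.bradshawGrujicKukavica2015_local_analyticity_radius`
(Bradshaw–Grujić–Kukavica 2015, Thm. 2.3; Grujić–Kukavica 1998: the analyticity region grows
like `√(t - s₀)` over the ball and degenerates at its boundary). The complex iterates of the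
contour scheme live, at time `s`, on the **profile region**

  `Ω_s = {cx x + i cx y : ‖y‖ < c √(s - s₀) ψ(x)}`     (`profileRegion (κ_s • ψ)`, `κ_s = c√(s-s₀)`),

`ψ = bump2 x₁` a fixed smooth bump with `0 ≤ ψ ≤ 1`, `ψ = 1` on `B̄(x₁,1)`, `{ψ > 0} = B(x₁,2)`.
To bound the flat Oseen integral at a point `cx x + i cx y ∈ Ω_t` from the time slice `s < t`
one deforms the contour `w ↦ cx w + i φ(w) y` with the **adapted profile**

  `φ(w) = λ ψ(w) H(ψ(w)/ψ(x))`,  `λ = √(s-s₀)/(ψ(x)√(t-s₀))`,  `H = stepH` (`0` below `1/4`,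
  `1` above `1/2`),

whose graph stays in `Ω_s` over `B(x₁,2)` (`adaptedProfile_graph_mem`), which is `C¹` with
compact support inside the open ball (`tsupport_adaptedProfile_subset`), whose residual shift is
admissible for the sector bounds, `‖(φ(w) - 1)y‖ ≤ ‖x - w‖/2 + √(t-s)`
(`adaptedProfile_residual_le`), and whose derivative along `y` is `≤ c√T L₀(1 + C_H/2)`
(`abs_fderiv_adaptedProfile_le`) — exactly the hypotheses of the localised deformed bound
`exists_norm_integral_oseenKernelC_flat_le_local`.

## References

* Z. Bradshaw, Z. Grujić, I. Kukavica, J. Differential Equations 259 (2015), Thm. 2.3, §3–§4.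
  [BradshawGrujicKukavica2015]
* Z. Grujić, I. Kukavica, J. Funct. Anal. 152 (1998), 447–466 (the growing regions). [GrujicKukavica1998]
-/

noncomputable section

open MeasureTheory Set Function Filter Metric Real
open _root_.Topology
open scoped ContDiff InnerProductSpace RealInnerProductSpace
open Literature.Analysis.FunctionSpaces.EuclideanSpace (complexify complexify_apply norm_complexify
  complexify_injective continuous_complexify)

namespace Literature.Analysis.FluidPDE

namespace BGK2015

/-! ### The smooth step `H` -/

/-- **The smooth step** `H = stepH`: `C^∞`, `0 ≤ H ≤ 1`, `H = 0` on `(-∞, 1/4]`, `H = 1` on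
`[1/2, ∞)`. [folklore] -/
def stepH (r : ℝ) : ℝ := Real.smoothTransition (4 * r - 1)

/-- `H` is smooth. [folklore] -/
theorem stepH_contDiff {n : ℕ∞} : ContDiff ℝ n stepH :=
  Real.smoothTransition.contDiff.comp ((contDiff_const.mul contDiff_id).sub contDiff_const)

/-- `0 ≤ H`. [folklore] -/
theorem stepH_nonneg (r : ℝ) : 0 ≤ stepH r := Real.smoothTransition.nonneg _

/-- `H ≤ 1`. [folklore] -/
theorem stepH_le_one (r : ℝ) : stepH r ≤ 1 := Real.smoothTransition.le_one _

/-- `H = 0` below `1/4`. [folklore] -/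
theorem stepH_of_le {r : ℝ} (hr : r ≤ 1 / 4) : stepH r = 0 :=
  Real.smoothTransition.zero_of_nonpos (by linarith)

/-- `H = 1` above `1/2`. [folklore] -/
theorem stepH_of_ge {r : ℝ} (hr : 1 / 2 ≤ r) : stepH r = 1 :=
  Real.smoothTransition.one_of_one_le (by linarith)

/-- A bound for the derivative of the smooth step. [folklore] -/
theorem exists_abs_deriv_stepH_le : ∃ C : ℝ, 0 ≤ C ∧ ∀ r, |deriv stepH r| ≤ C := by
  have h1 : ContDiff ℝ 1 stepH := stepH_contDiff
  have hc : Continuous (deriv stepH) := h1.continuous_deriv le_rfl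
  -- `deriv stepH` vanishes off `[1/4, 1/2]`, a compact set
  have hzero : ∀ r, r ∉ Icc (1 / 4 : ℝ) (1 / 2) → deriv stepH r = 0 := by
    intro r hr
    rw [mem_Icc, not_and_or, not_le, not_le] at hr
    rcases hr with h | h
    · have : stepH =ᶠ[𝓝 r] fun _ => 0 := by
        filter_upwards [Iio_mem_nhds h] with s hs using stepH_of_le (le_of_lt hs)
      rw [this.deriv_eq, deriv_const]
    · have : stepH =ᶠ[𝓝 r] fun _ => 1 := by
        filter_upwards [Ioi_mem_nhds h] with s hs using stepH_of_ge (le_of_lt hs)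
      rw [this.deriv_eq, deriv_const]
  obtain ⟨C, hC⟩ := isCompact_Icc.exists_bound_of_continuousOn (f := deriv stepH) hc.continuousOn
  refine ⟨max C 0, le_max_right _ _, fun r => ?_⟩
  by_cases hr : r ∈ Icc (1 / 4 : ℝ) (1 / 2)
  · exact (Real.norm_eq_abs _ ▸ hC r hr).trans (le_max_left _ _)
  · rw [hzero r hr, abs_zero]; exact le_max_right _ _

/-! ### The bump `ψ` over the ball of radius `2` -/

/-- **The bump** `ψ = bump2 x₁`: `ψ(x) = S((4 - ‖x - x₁‖²)/3)` with `S` the smooth transition —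
`C^∞`, `0 ≤ ψ ≤ 1`, `ψ = 1` on `B̄(x₁, 1)`, `ψ > 0` exactly on `B(x₁, 2)`. [folklore] -/
def bump2 (x₁ x : EuclideanSpace ℝ (Fin 3)) : ℝ :=
  Real.smoothTransition ((4 - ‖x - x₁‖ ^ 2) / 3)

/-- The bump is the translate of the centred bump. [folklore] -/
theorem bump2_eq_comp (x₁ : EuclideanSpace ℝ (Fin 3)) :
    bump2 x₁ = fun x => bump2 0 (x - x₁) := by
  funext x; simp [bump2]

/-- The bump is smooth. [folklore] -/
theorem bump2_contDiff (x₁ : EuclideanSpace ℝ (Fin 3)) {n : ℕ∞} : ContDiff ℝ n (bump2 x₁) := by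
  unfold bump2
  refine Real.smoothTransition.contDiff.comp ?_
  exact (contDiff_const.sub ((contDiff_norm_sq ℝ).comp (contDiff_id.sub contDiff_const))).div_const _

/-- `0 ≤ ψ`. [folklore] -/
theorem bump2_nonneg (x₁ x : EuclideanSpace ℝ (Fin 3)) : 0 ≤ bump2 x₁ x := Real.smoothTransition.nonneg _

/-- `ψ ≤ 1`. [folklore] -/
theorem bump2_le_one (x₁ x : EuclideanSpace ℝ (Fin 3)) : bump2 x₁ x ≤ 1 := Real.smoothTransition.le_one _

/-- `ψ = 1` on `B̄(x₁, 1)`. [folklore] -/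
theorem bump2_eq_one_of_mem {x₁ x : EuclideanSpace ℝ (Fin 3)} (hx : x ∈ closedBall x₁ 1) :
    bump2 x₁ x = 1 := by
  refine Real.smoothTransition.one_of_one_le ?_
  rw [mem_closedBall, dist_eq_norm] at hx
  have : ‖x - x₁‖ ^ 2 ≤ 1 := by nlinarith [norm_nonneg (x - x₁)]
  linarith

/-- `ψ(x) > 0 ↔ x ∈ B(x₁, 2)`. [folklore] -/
theorem bump2_pos_iff {x₁ x : EuclideanSpace ℝ (Fin 3)} : 0 < bump2 x₁ x ↔ x ∈ ball x₁ 2 := by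
  rw [mem_ball, dist_eq_norm, bump2]
  constructor
  · intro h
    by_contra hx
    push Not at hx
    have : (4 - ‖x - x₁‖ ^ 2) / 3 ≤ 0 := by
      have : 4 ≤ ‖x - x₁‖ ^ 2 := by nlinarith
      linarith
    exact (Real.smoothTransition.zero_of_nonpos this ▸ h).false
  · intro h
    refine Real.smoothTransition.pos_of_pos ?_
    have : ‖x - x₁‖ ^ 2 < 4 := by nlinarith [norm_nonneg (x - x₁)]
    linarith

/-- `ψ = 0` off `B(x₁, 2)`. [folklore] -/
theorem bump2_eq_zero_of_notMem {x₁ x : EuclideanSpace ℝ (Fin 3)} (hx : x ∉ ball x₁ 2) :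
    bump2 x₁ x = 0 :=
  le_antisymm (not_lt.1 fun h => hx (bump2_pos_iff.1 h)) (bump2_nonneg _ _)

/-- `ψ > 0` on `B(x₁, 2)`. [folklore] -/
theorem bump2_pos_of_mem {x₁ x : EuclideanSpace ℝ (Fin 3)} (hx : x ∈ ball x₁ 2) : 0 < bump2 x₁ x :=
  bump2_pos_iff.2 hx

/-- **A uniform Lipschitz / gradient bound for the bump**, independent of the centre. [folklore] -/
theorem exists_bump2_lipschitz : ∃ L₀ : ℝ, 0 < L₀ ∧
    (∀ x₁ x : EuclideanSpace ℝ (Fin 3), ‖fderiv ℝ (bump2 x₁) x‖ ≤ L₀) ∧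
    ∀ x₁ x w : EuclideanSpace ℝ (Fin 3), |bump2 x₁ x - bump2 x₁ w| ≤ L₀ * ‖x - w‖ := by
  -- the centred bump has compactly supported continuous derivative
  have h1 : ContDiff ℝ 1 (bump2 0) := bump2_contDiff 0
  have hsupp : HasCompactSupport (bump2 (0 : EuclideanSpace ℝ (Fin 3))) := by
    refine HasCompactSupport.of_support_subset_isCompact (isCompact_closedBall 0 2) fun x hx => ?_
    by_contra h
    exact hx (bump2_eq_zero_of_notMem fun h' => h (ball_subset_closedBall h'))
  obtain ⟨C, hC⟩ := (h1.continuous_fderiv one_ne_zero).bounded_above_of_compact_support (hsupp.fderiv ℝ)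
  have hC0 : 0 ≤ C := (norm_nonneg _).trans (hC 0)
  refine ⟨C + 1, by linarith, fun x₁ x => ?_, fun x₁ x w => ?_⟩
  · rw [bump2_eq_comp x₁]
    have hcomp : fderiv ℝ (fun x => bump2 0 (x - x₁)) x = fderiv ℝ (bump2 0) (x - x₁) := by
      have h := ((h1.differentiable one_ne_zero (x - x₁)).hasFDerivAt.comp x
        ((hasFDerivAt_id x).sub_const x₁)).fderiv
      rw [ContinuousLinearMap.comp_id] at h
      exact h
    rw [hcomp]
    exact (hC _).trans (by linarith)
  · rw [bump2_eq_comp x₁]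
    have h := (convex_univ (𝕜 := ℝ) (E := EuclideanSpace ℝ (Fin 3))).norm_image_sub_le_of_norm_fderiv_le
      (f := bump2 (0 : EuclideanSpace ℝ (Fin 3))) (fun y _ => h1.differentiable one_ne_zero y)
      (fun y _ => hC y) (mem_univ (w - x₁)) (mem_univ (x - x₁))
    rw [Real.norm_eq_abs, show x - x₁ - (w - x₁) = x - w by abel] at h
    exact h.trans (mul_le_mul_of_nonneg_right (by linarith) (norm_nonneg _))

/-! ### The profile regions -/

/-- **The profile region** of a height function `g`:
`profileRegion g = {cx x + i cx y : ‖y‖ < g x}`. [cite: GrujicKukavica1998, §2] -/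
def profileRegion (g : EuclideanSpace ℝ (Fin 3) → ℝ) : Set (EuclideanSpace ℂ (Fin 3)) :=
  {z | ∃ x y : EuclideanSpace ℝ (Fin 3), ‖y‖ < g x ∧ z = complexify x + Complex.I • complexify y}

/-- Membership of `cx x + i cx y` in the profile region. [folklore] -/
theorem complexify_add_I_smul_mem_profileRegion_iff {g : EuclideanSpace ℝ (Fin 3) → ℝ}
    {x y : EuclideanSpace ℝ (Fin 3)} :
    complexify x + Complex.I • complexify y ∈ profileRegion g ↔ ‖y‖ < g x := by
  refine ⟨?_, fun h => ⟨x, y, h, rfl⟩⟩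
  rintro ⟨x', y', h', hz⟩
  have hxx' : x = x' := by
    ext i
    have hi := congrArg (fun w : EuclideanSpace ℂ (Fin 3) => (w i).re) hz
    simpa only [re_complexify_add_I_smul_complexify_apply] using hi
  have hyy' : y = y' := by
    ext i
    have hi := congrArg (fun w : EuclideanSpace ℂ (Fin 3) => (w i).im) hz
    simpa only [im_complexify_add_I_smul_complexify_apply] using hi
  rw [hxx', hyy']; exact h'

/-- A real point lies in the profile region iff the height there is positive. [folklore] -/
theorem complexify_mem_profileRegion_iff {g : EuclideanSpace ℝ (Fin 3) → ℝ} {x : EuclideanSpace ℝ (Fin 3)} :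
    complexify x ∈ profileRegion g ↔ 0 < g x := by
  have h := complexify_add_I_smul_mem_profileRegion_iff (g := g) (x := x) (y := 0)
  rwa [map_zero, smul_zero, add_zero, norm_zero] at h

/-- The profile region is monotone in the height. [folklore] -/
theorem profileRegion_mono {g h : EuclideanSpace ℝ (Fin 3) → ℝ} (hgh : ∀ x, g x ≤ h x) :
    profileRegion g ⊆ profileRegion h := by
  rintro z ⟨x, y, hy, rfl⟩
  exact ⟨x, y, hy.trans_le (hgh x), rfl⟩

/-- **The profile region of a continuous height is open.** [folklore] -/
theorem isOpen_profileRegion {g : EuclideanSpace ℝ (Fin 3) → ℝ} (hg : Continuous g) :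
    IsOpen (profileRegion g) := by
  set re : EuclideanSpace ℂ (Fin 3) → EuclideanSpace ℝ (Fin 3) :=
    fun z => WithLp.toLp 2 fun i => (z i).re with hre_def
  set im : EuclideanSpace ℂ (Fin 3) → EuclideanSpace ℝ (Fin 3) :=
    fun z => WithLp.toLp 2 fun i => (z i).im with him_def
  have hre : Continuous re := by rw [hre_def]; fun_prop
  have him : Continuous im := by rw [him_def]; fun_prop
  have heq : profileRegion g = {z | ‖im z‖ < g (re z)} := by
    ext z
    obtain ⟨x, y, hz, hx, hy⟩ := exists_eq_complexify_add_I_smul_complexify z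
    have hxz : re z = x := by ext i; exact (hx i).symm
    have hyz : im z = y := by ext i; exact (hy i).symm
    rw [hz, complexify_add_I_smul_mem_profileRegion_iff, ← hz, mem_setOf_eq, hxz, hyz]
  rw [heq]
  exact isOpen_lt (continuous_norm.comp him) (hg.comp hre)

/-- **Decomposition of a point of `Ω_κ = profileRegion (κ ψ)`**: `z = cx x + i cx y` with
`x ∈ B(x₁, 2)`, `0 < ψ(x)`, `‖y‖ < κ ψ(x)`, `‖y‖ < κ` (and `κ > 0`). [folklore] -/
theorem mem_profileRegion_bump2 {x₁ : EuclideanSpace ℝ (Fin 3)} {κ : ℝ}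
    {z : EuclideanSpace ℂ (Fin 3)} (hz : z ∈ profileRegion (fun x => κ * bump2 x₁ x)) :
    ∃ x y : EuclideanSpace ℝ (Fin 3), z = complexify x + Complex.I • complexify y ∧
      x ∈ ball x₁ 2 ∧ 0 < bump2 x₁ x ∧ ‖y‖ < κ * bump2 x₁ x ∧ ‖y‖ < κ ∧ 0 < κ := by
  obtain ⟨x, y, hy, rfl⟩ := hz
  have hy : ‖y‖ < κ * bump2 x₁ x := hy
  have hpos : 0 < bump2 x₁ x := by
    by_contra h
    have h0 : bump2 x₁ x = 0 := le_antisymm (not_lt.1 h) (bump2_nonneg _ _)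
    rw [h0, mul_zero] at hy
    exact not_lt.2 (norm_nonneg y) hy
  have hκ0 : 0 < κ := by
    by_contra h
    have : κ * bump2 x₁ x ≤ 0 := mul_nonpos_of_nonpos_of_nonneg (not_lt.1 h) (bump2_nonneg _ _)
    exact not_lt.2 (norm_nonneg y) (hy.trans_le this)
  exact ⟨x, y, rfl, bump2_pos_iff.1 hpos, hpos, hy,
    hy.trans_le (mul_le_of_le_one_right hκ0.le (bump2_le_one _ _)), hκ0⟩

/-- **The local tube of height `κ` over `B(x₁, 1)` lies in `Ω_κ`** (`ψ = 1` there). [folklore] -/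
theorem localComplexTube_subset_profileRegion (x₁ : EuclideanSpace ℝ (Fin 3)) (κ : ℝ) :
    localComplexTube x₁ 1 κ ⊆ profileRegion (fun x => κ * bump2 x₁ x) := by
  rintro z ⟨x, y, hx, hy, rfl⟩
  refine ⟨x, y, ?_, rfl⟩
  show ‖y‖ < κ * bump2 x₁ x
  rwa [bump2_eq_one_of_mem (mem_closedBall.2 hx.le), mul_one]

/-- `Ω_κ` lies in the local tube of height `κ` over `B(x₁, 2)`. [folklore] -/
theorem profileRegion_subset_localComplexTube (x₁ : EuclideanSpace ℝ (Fin 3)) (κ : ℝ) :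
    profileRegion (fun x => κ * bump2 x₁ x) ⊆ localComplexTube x₁ 2 κ := by
  intro z hz
  obtain ⟨x, y, rfl, hx, -, -, hy, -⟩ := mem_profileRegion_bump2 hz
  exact ⟨x, y, hx, hy, rfl⟩

/-! ### The adapted profile -/

/-- **The adapted contour profile** at the target real point `x` with amplitude `lam`:
`φ(w) = lam ψ(w) H(ψ(w)/ψ(x))`. [cite: BradshawGrujicKukavica2015, §3 (the cut-off `ψ`)] -/
def adaptedProfile (x₁ x : EuclideanSpace ℝ (Fin 3)) (lam : ℝ) (w : EuclideanSpace ℝ (Fin 3)) : ℝ :=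
  lam * bump2 x₁ w * stepH (bump2 x₁ w / bump2 x₁ x)

section Profile

variable {x₁ x : EuclideanSpace ℝ (Fin 3)} {lam : ℝ}

/-- The adapted profile is smooth. [folklore] -/
theorem adaptedProfile_contDiff (x₁ x : EuclideanSpace ℝ (Fin 3)) (lam : ℝ) {n : ℕ∞} :
    ContDiff ℝ n (adaptedProfile x₁ x lam) := by
  unfold adaptedProfile
  exact (contDiff_const.mul (bump2_contDiff x₁)).mul (stepH_contDiff.comp ((bump2_contDiff x₁).div_const _))

/-- `0 ≤ φ` for `lam ≥ 0`. [folklore] -/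
theorem adaptedProfile_nonneg (hlam : 0 ≤ lam) (w : EuclideanSpace ℝ (Fin 3)) : 0 ≤ adaptedProfile x₁ x lam w :=
  mul_nonneg (mul_nonneg hlam (bump2_nonneg _ _)) (stepH_nonneg _)

/-- `φ ≤ lam ψ` for `lam ≥ 0`. [folklore] -/
theorem adaptedProfile_le (hlam : 0 ≤ lam) (w : EuclideanSpace ℝ (Fin 3)) :
    adaptedProfile x₁ x lam w ≤ lam * bump2 x₁ w :=
  mul_le_of_le_one_right (mul_nonneg hlam (bump2_nonneg _ _)) (stepH_le_one _)

/-- Where `ψ(w) ≥ ψ(x)/2` the step is saturated: `φ(w) = lam ψ(w)`. [folklore] -/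
theorem adaptedProfile_of_ge (hx : 0 < bump2 x₁ x) {w : EuclideanSpace ℝ (Fin 3)}
    (hw : bump2 x₁ x / 2 ≤ bump2 x₁ w) : adaptedProfile x₁ x lam w = lam * bump2 x₁ w := by
  unfold adaptedProfile
  rw [stepH_of_ge, mul_one]
  rw [le_div_iff₀ hx]; linarith

/-- Where `ψ(w) ≤ ψ(x)/4` the profile vanishes. [folklore] -/
theorem adaptedProfile_of_le (hx : 0 < bump2 x₁ x) {w : EuclideanSpace ℝ (Fin 3)}
    (hw : bump2 x₁ w ≤ bump2 x₁ x / 4) : adaptedProfile x₁ x lam w = 0 := by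
  unfold adaptedProfile
  rw [stepH_of_le, mul_zero]
  rw [div_le_iff₀ hx]; linarith

/-- **The profile is supported well inside the ball**: `tsupport φ ⊆ {ψ ≥ ψ(x)/4} ⊆ B(x₁, 2)`.
[folklore] -/
theorem tsupport_adaptedProfile_subset (hx : 0 < bump2 x₁ x) :
    tsupport (adaptedProfile x₁ x lam) ⊆ {w | bump2 x₁ x / 4 ≤ bump2 x₁ w} := by
  refine closure_minimal (fun w hw => ?_) (isClosed_le continuous_const (bump2_contDiff x₁ (n := 0)).continuous)
  by_contra h
  exact hw (adaptedProfile_of_le hx (le_of_lt (not_le.1 h)))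

/-- `tsupport φ ⊆ B(x₁, 2)`. [folklore] -/
theorem tsupport_adaptedProfile_subset_ball (hx : 0 < bump2 x₁ x) :
    tsupport (adaptedProfile x₁ x lam) ⊆ ball x₁ 2 := fun w hw =>
  bump2_pos_iff.1 (lt_of_lt_of_le (by linarith) (tsupport_adaptedProfile_subset hx hw))

/-- `φ` has compact support. [folklore] -/
theorem hasCompactSupport_adaptedProfile (hx : 0 < bump2 x₁ x) :
    HasCompactSupport (adaptedProfile x₁ x lam) :=
  HasCompactSupport.of_support_subset_isCompact (isCompact_closedBall x₁ 2)
    ((subset_tsupport _).trans ((tsupport_adaptedProfile_subset_ball hx).trans ball_subset_closedBall))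

/-- **The graph of the profile stays in the region of the earlier time**: with
`lam = κ_s/(κ_t ψ(x))` and `‖y‖ < κ_t ψ(x)`, for `w ∈ B(x₁, 2)` and `θ ∈ [0,1]`,
`cx w + i cx ((θ φ(w)) y) ∈ Ω_{κ_s}`. [cite: GrujicKukavica1998, §2] -/
theorem adaptedProfile_graph_mem (hx : 0 < bump2 x₁ x) {κs κt : ℝ} (hκs : 0 < κs) (hκt : 0 < κt)
    (hlam : lam = κs / (κt * bump2 x₁ x)) {y : EuclideanSpace ℝ (Fin 3)} (hy : ‖y‖ < κt * bump2 x₁ x)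
    {w : EuclideanSpace ℝ (Fin 3)} (hw : w ∈ ball x₁ 2) {θ : ℝ} (hθ : θ ∈ Icc (0 : ℝ) 1) :
    complexify w + Complex.I • complexify ((θ * adaptedProfile x₁ x lam w) • y) ∈
      profileRegion (fun v => κs * bump2 x₁ v) := by
  rw [complexify_add_I_smul_mem_profileRegion_iff, norm_smul, Real.norm_eq_abs]
  have hψw := bump2_pos_of_mem hw
  have hlam0 : 0 < lam := by rw [hlam]; positivity
  have hφ0 := adaptedProfile_nonneg hlam0.le w (x₁ := x₁) (x := x)
  rw [abs_of_nonneg (mul_nonneg hθ.1 hφ0)]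
  have h1 : θ * adaptedProfile x₁ x lam w ≤ lam * bump2 x₁ w :=
    (mul_le_of_le_one_left hφ0 hθ.2).trans (adaptedProfile_le hlam0.le w)
  have h2 : lam * ‖y‖ < κs := by
    rw [hlam, div_mul_eq_mul_div, div_lt_iff₀ (by positivity)]
    calc κs * ‖y‖ < κs * (κt * bump2 x₁ x) := mul_lt_mul_of_pos_left hy hκs
      _ = κs * (κt * bump2 x₁ x) := rfl
  calc θ * adaptedProfile x₁ x lam w * ‖y‖ ≤ lam * bump2 x₁ w * ‖y‖ :=
        mul_le_mul_of_nonneg_right h1 (norm_nonneg _)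
    _ = (lam * ‖y‖) * bump2 x₁ w := by ring
    _ < κs * bump2 x₁ w := mul_lt_mul_of_pos_right h2 hψw

/-- `√b - √a ≤ √(b - a)` for `0 ≤ a ≤ b`. [folklore] -/
theorem sqrt_sub_sqrt_le_sqrt_sub {a b : ℝ} (ha : 0 ≤ a) (hab : a ≤ b) :
    Real.sqrt b - Real.sqrt a ≤ Real.sqrt (b - a) := by
  rw [sub_le_iff_le_add]
  have hba : 0 ≤ b - a := sub_nonneg.2 hab
  have h : b ≤ (Real.sqrt (b - a) + Real.sqrt a) ^ 2 := by
    nlinarith [Real.sq_sqrt hba, Real.sq_sqrt ha, Real.sqrt_nonneg (b - a), Real.sqrt_nonneg a]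
  calc Real.sqrt b ≤ Real.sqrt ((Real.sqrt (b - a) + Real.sqrt a) ^ 2) := Real.sqrt_le_sqrt h
    _ = Real.sqrt (b - a) + Real.sqrt a := Real.sqrt_sq (by positivity)

/-- **Admissibility of the residual shift of the adapted profile**: with `ψ` `L₀`-Lipschitz,
`c ≤ 1`, `c L₀ √T ≤ 1/4`, `s₀ < s < t`, `t - s₀ ≤ T`, `κ_r = c√(r - s₀)`,
`lam = κ_s/(κ_t ψ(x))` and `‖y‖ < κ_t ψ(x)`: for every `w`,
`‖(φ(w) - 1) y‖ ≤ ‖x - w‖/2 + √(t - s)`. [cite: GrujicKukavica1998, §2] -/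
theorem adaptedProfile_residual_le (hx : 0 < bump2 x₁ x) {L₀ : ℝ}
    (hLip : ∀ v w : EuclideanSpace ℝ (Fin 3), |bump2 x₁ v - bump2 x₁ w| ≤ L₀ * ‖v - w‖)
    {c T s₀ s t : ℝ} (hc : 0 < c) (hc1 : c ≤ 1) (hcL : c * L₀ * Real.sqrt T ≤ 1 / 4)
    (hs : s₀ < s) (hst : s < t) (htT : t - s₀ ≤ T)
    (hlam : lam = (c * Real.sqrt (s - s₀)) / ((c * Real.sqrt (t - s₀)) * bump2 x₁ x))
    {y : EuclideanSpace ℝ (Fin 3)} (hy : ‖y‖ < (c * Real.sqrt (t - s₀)) * bump2 x₁ x)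
    (w : EuclideanSpace ℝ (Fin 3)) :
    ‖(adaptedProfile x₁ x lam w - 1) • y‖ ≤ ‖x - w‖ / 2 + Real.sqrt (t - s) := by
  set a : ℝ := bump2 x₁ x with ha
  have hts₀ : 0 < t - s₀ := by linarith
  have hss₀ : 0 < s - s₀ := by linarith
  have hsq_t : 0 < Real.sqrt (t - s₀) := Real.sqrt_pos.2 hts₀
  have hlam' : lam = Real.sqrt (s - s₀) / (Real.sqrt (t - s₀) * a) := by
    rw [hlam, ha]; field_simp
  have hlam0 : 0 < lam := by rw [hlam']; positivity
  have hT0 : 0 < T := lt_of_lt_of_le hts₀ htT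
  have hsqT : Real.sqrt (t - s₀) ≤ Real.sqrt T := Real.sqrt_le_sqrt htT
  have hy' : ‖y‖ ≤ c * Real.sqrt T * a := by
    refine hy.le.trans ?_
    exact mul_le_mul_of_nonneg_right (mul_le_mul_of_nonneg_left hsqT hc.le) (bump2_nonneg _ _)
  have ha1 : a ≤ 1 := bump2_le_one _ _
  rw [norm_smul, Real.norm_eq_abs]
  by_cases hw : a / 2 ≤ bump2 x₁ w
  · -- saturated step: `φ(w) = lam ψ(w)`
    rw [adaptedProfile_of_ge hx hw, hlam']
    have hkey : |Real.sqrt (s - s₀) / (Real.sqrt (t - s₀) * a) * bump2 x₁ w - 1| * ‖y‖ ≤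
        c * |Real.sqrt (s - s₀) * bump2 x₁ w - Real.sqrt (t - s₀) * a| := by
      have e : Real.sqrt (s - s₀) / (Real.sqrt (t - s₀) * a) * bump2 x₁ w - 1 =
          (Real.sqrt (s - s₀) * bump2 x₁ w - Real.sqrt (t - s₀) * a) / (Real.sqrt (t - s₀) * a) := by
        field_simp
      rw [e, abs_div, abs_of_pos (by positivity : 0 < Real.sqrt (t - s₀) * a), div_mul_eq_mul_div,
        div_le_iff₀ (by positivity)]
      calc |Real.sqrt (s - s₀) * bump2 x₁ w - Real.sqrt (t - s₀) * a| * ‖y‖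
          ≤ |Real.sqrt (s - s₀) * bump2 x₁ w - Real.sqrt (t - s₀) * a| * (c * Real.sqrt (t - s₀) * a) :=
            mul_le_mul_of_nonneg_left hy.le (abs_nonneg _)
        _ = c * |Real.sqrt (s - s₀) * bump2 x₁ w - Real.sqrt (t - s₀) * a| * (Real.sqrt (t - s₀) * a) := by ring
    refine hkey.trans ?_
    -- `|√(s-s₀)ψ(w) - √(t-s₀)a| ≤ √(s-s₀)|ψ(w) - a| + a(√(t-s₀) - √(s-s₀))`
    have hsplit : |Real.sqrt (s - s₀) * bump2 x₁ w - Real.sqrt (t - s₀) * a| ≤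
        Real.sqrt (s - s₀) * |bump2 x₁ w - a| + a * (Real.sqrt (t - s₀) - Real.sqrt (s - s₀)) := by
      have e : Real.sqrt (s - s₀) * bump2 x₁ w - Real.sqrt (t - s₀) * a =
          Real.sqrt (s - s₀) * (bump2 x₁ w - a) - a * (Real.sqrt (t - s₀) - Real.sqrt (s - s₀)) := by ring
      rw [e]
      refine (abs_sub _ _).trans ?_
      rw [abs_mul, abs_of_nonneg (Real.sqrt_nonneg _), abs_mul, abs_of_nonneg hx.le,
        abs_of_nonneg (sub_nonneg.2 (Real.sqrt_le_sqrt (by linarith)))]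
    have hLw : |bump2 x₁ w - a| ≤ L₀ * ‖x - w‖ := by
      rw [abs_sub_comm]; exact hLip x w
    have hsqrt : Real.sqrt (t - s₀) - Real.sqrt (s - s₀) ≤ Real.sqrt (t - s) := by
      have h := sqrt_sub_sqrt_le_sqrt_sub hss₀.le (by linarith : s - s₀ ≤ t - s₀)
      rwa [show t - s₀ - (s - s₀) = t - s by ring] at h
    have hss : Real.sqrt (s - s₀) ≤ Real.sqrt T := Real.sqrt_le_sqrt (by linarith)
    calc c * |Real.sqrt (s - s₀) * bump2 x₁ w - Real.sqrt (t - s₀) * a|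
        ≤ c * (Real.sqrt (s - s₀) * |bump2 x₁ w - a| + a * (Real.sqrt (t - s₀) - Real.sqrt (s - s₀))) :=
          mul_le_mul_of_nonneg_left hsplit hc.le
      _ ≤ c * (Real.sqrt T * (L₀ * ‖x - w‖) + 1 * Real.sqrt (t - s)) := by
          gcongr
          · exact sub_nonneg.2 (Real.sqrt_le_sqrt (by linarith))
      _ = (c * L₀ * Real.sqrt T) * ‖x - w‖ + c * Real.sqrt (t - s) := by ring
      _ ≤ (1 / 4) * ‖x - w‖ + 1 * Real.sqrt (t - s) := by
          gcongr
      _ ≤ ‖x - w‖ / 2 + Real.sqrt (t - s) := by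
          have := norm_nonneg (x - w); linarith
  · -- far from `x`: `ψ(w) < a/2`, so `‖x - w‖ ≥ a/(2L₀)` and `0 ≤ φ(w) ≤ 1/2`
    push Not at hw
    have hdist : a / 2 ≤ L₀ * ‖x - w‖ := by
      have h := hLip x w
      rw [← ha] at h
      have : a / 2 < |a - bump2 x₁ w| := by
        rw [abs_of_nonneg (by linarith)]; linarith
      linarith
    have hyw : ‖y‖ ≤ ‖x - w‖ / 2 := by
      calc ‖y‖ ≤ c * Real.sqrt T * a := hy'
        _ ≤ c * Real.sqrt T * (2 * (L₀ * ‖x - w‖)) := by gcongr; linarith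
        _ = 2 * (c * L₀ * Real.sqrt T) * ‖x - w‖ := by ring
        _ ≤ 2 * (1 / 4) * ‖x - w‖ := by gcongr
        _ = ‖x - w‖ / 2 := by ring
    have hφle : adaptedProfile x₁ x lam w ≤ 1 / 2 := by
      calc adaptedProfile x₁ x lam w ≤ lam * bump2 x₁ w := adaptedProfile_le hlam0.le w
        _ ≤ lam * (a / 2) := mul_le_mul_of_nonneg_left hw.le hlam0.le
        _ = Real.sqrt (s - s₀) / Real.sqrt (t - s₀) / 2 := by rw [hlam']; field_simp
        _ ≤ 1 / 2 := by
            have : Real.sqrt (s - s₀) / Real.sqrt (t - s₀) ≤ 1 := by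
              rw [div_le_one hsq_t]; exact Real.sqrt_le_sqrt (by linarith)
            linarith
    have hφ0 := adaptedProfile_nonneg hlam0.le w (x₁ := x₁) (x := x)
    have habs : |adaptedProfile x₁ x lam w - 1| ≤ 1 := by
      rw [abs_sub_comm, abs_of_nonneg (by linarith)]; linarith
    calc |adaptedProfile x₁ x lam w - 1| * ‖y‖ ≤ 1 * (‖x - w‖ / 2) :=
          mul_le_mul habs hyw (norm_nonneg _) zero_le_one
      _ ≤ ‖x - w‖ / 2 + Real.sqrt (t - s) := by
          have := Real.sqrt_nonneg (t - s); linarith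

/-- **The derivative of the adapted profile along `y`**: with `|H'| ≤ C_H`, `‖Dψ‖ ≤ L₀`,
`lam ‖y‖ ≤ κ` (`κ = c√(s - s₀)`): `|Dφ(w) y| ≤ κ L₀ (1 + 2 C_H)` for every `w`. [folklore] -/
theorem abs_fderiv_adaptedProfile_le (hx : 0 < bump2 x₁ x) (hlam : 0 ≤ lam) {L₀ C_H : ℝ}
    (hL₀ : ∀ w, ‖fderiv ℝ (bump2 x₁) w‖ ≤ L₀) (hCH0 : 0 ≤ C_H) (hCH : ∀ r, |deriv stepH r| ≤ C_H)
    {y : EuclideanSpace ℝ (Fin 3)} {κ : ℝ} (hyκ : lam * ‖y‖ ≤ κ) (w : EuclideanSpace ℝ (Fin 3)) :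
    |fderiv ℝ (adaptedProfile x₁ x lam) w y| ≤ κ * L₀ * (1 + 2 * C_H) := by
  set a : ℝ := bump2 x₁ x with ha
  have hL₀0 : 0 ≤ L₀ := (norm_nonneg _).trans (hL₀ w)
  have hψd : Differentiable ℝ (bump2 x₁) := (bump2_contDiff x₁ (n := 1)).differentiable one_ne_zero
  have hHd : Differentiable ℝ stepH := (stepH_contDiff (n := 1)).differentiable one_ne_zero
  -- the derivative of `φ = lam ψ · (H ∘ (ψ/a))`
  have hfa : HasFDerivAt (fun w => bump2 x₁ w / a) (a⁻¹ • fderiv ℝ (bump2 x₁) w) w := by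
    have h := ((hψd w).hasFDerivAt).const_mul a⁻¹
    refine h.congr_of_eventuallyEq (Eventually.of_forall fun v => ?_)
    simp [div_eq_inv_mul]
  have hHa : HasFDerivAt (fun w => stepH (bump2 x₁ w / a))
      (deriv stepH (bump2 x₁ w / a) • (a⁻¹ • fderiv ℝ (bump2 x₁) w)) w :=
    (hHd _).hasDerivAt.comp_hasFDerivAt w hfa
  have hlamψ : HasFDerivAt (fun v => lam * bump2 x₁ v) (lam • fderiv ℝ (bump2 x₁) w) w :=
    ((hψd w).hasFDerivAt).const_mul lam
  have hderiv : fderiv ℝ (adaptedProfile x₁ x lam) w y =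
      lam * (fderiv ℝ (bump2 x₁) w y) * stepH (bump2 x₁ w / a) +
        lam * bump2 x₁ w * (deriv stepH (bump2 x₁ w / a) * (fderiv ℝ (bump2 x₁) w y / a)) := by
    have h1 : adaptedProfile x₁ x lam = fun w => (lam * bump2 x₁ w) * stepH (bump2 x₁ w / a) := rfl
    rw [h1, fderiv_fun_mul hlamψ.differentiableAt hHa.differentiableAt, hHa.fderiv, hlamψ.fderiv]
    simp only [_root_.add_apply, _root_.smul_apply, smul_eq_mul]
    field_simp
    ring
  rw [hderiv]
  have hDy : |fderiv ℝ (bump2 x₁) w y| ≤ L₀ * ‖y‖ := by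
    rw [← Real.norm_eq_abs]
    exact (ContinuousLinearMap.le_opNorm _ _).trans (mul_le_mul_of_nonneg_right (hL₀ w) (norm_nonneg _))
  have hψw0 := bump2_nonneg x₁ w
  have hH1 : |stepH (bump2 x₁ w / a)| ≤ 1 := by
    rw [abs_of_nonneg (stepH_nonneg _)]; exact stepH_le_one _
  -- the second term only lives where `ψ(w)/a ≤ 1/2`
  have hterm2 : |lam * bump2 x₁ w * (deriv stepH (bump2 x₁ w / a) * (fderiv ℝ (bump2 x₁) w y / a))| ≤
      lam * (2 * C_H) * (L₀ * ‖y‖) := by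
    by_cases hw : bump2 x₁ w / a ≤ 1 / 2
    · have hwa : bump2 x₁ w ≤ a / 2 := by rw [div_le_iff₀ hx] at hw; linarith
      rw [abs_mul, abs_mul, abs_of_nonneg hlam, abs_of_nonneg hψw0, abs_mul, abs_div, abs_of_pos hx]
      calc lam * bump2 x₁ w * (|deriv stepH (bump2 x₁ w / a)| * (|fderiv ℝ (bump2 x₁) w y| / a))
          ≤ lam * (a / 2) * (C_H * (L₀ * ‖y‖ / a)) := by gcongr; exact hCH _
        _ = lam * (C_H / 2) * (L₀ * ‖y‖) := by field_simp
        _ ≤ lam * (2 * C_H) * (L₀ * ‖y‖) := by gcongr; linarith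
    · -- `H` is constant `1` near `ψ(w)/a > 1/2`: its derivative vanishes
      push Not at hw
      have hD0 : deriv stepH (bump2 x₁ w / a) = 0 := by
        have : stepH =ᶠ[𝓝 (bump2 x₁ w / a)] fun _ => 1 := by
          filter_upwards [Ioi_mem_nhds hw] with r hr using stepH_of_ge (le_of_lt hr)
        rw [this.deriv_eq, deriv_const]
      rw [hD0, zero_mul, mul_zero, abs_zero]
      positivity
  calc |lam * fderiv ℝ (bump2 x₁) w y * stepH (bump2 x₁ w / a) +
        lam * bump2 x₁ w * (deriv stepH (bump2 x₁ w / a) * (fderiv ℝ (bump2 x₁) w y / a))|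
      ≤ |lam * fderiv ℝ (bump2 x₁) w y * stepH (bump2 x₁ w / a)| +
          |lam * bump2 x₁ w * (deriv stepH (bump2 x₁ w / a) * (fderiv ℝ (bump2 x₁) w y / a))| := abs_add_le _ _
    _ ≤ lam * (L₀ * ‖y‖) * 1 + lam * (2 * C_H) * (L₀ * ‖y‖) := by
        refine add_le_add ?_ hterm2
        rw [abs_mul, abs_mul, abs_of_nonneg hlam]
        gcongr
    _ = (lam * ‖y‖) * L₀ * (1 + 2 * C_H) := by ring
    _ ≤ κ * L₀ * (1 + 2 * C_H) := by gcongr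

end Profile

end BGK2015

end Literature.Analysis.FluidPDE
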